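import Summits.CriticalPhenomena.PercolationContinuityZ3.Theorems.PercNearOneGluingNoHeavyQuantRootDecPairSet
import HarnessLib

/-!
# QUANT lane R8, Conjecture DIB\* — CELL F1 ('exactly one blob of size > j/2') REDUCED TO ONE REAL INEQUALITY (`OneBigCert`)

builds on p205010 (kernel theorem, internal audit signed; external expert review pending)

Statement + support file (`--supports stmt-CriticalPhenomena-4575`), QUANT lane lead (gen 19); memo
`run/shared/lean/prim/quant/prim-quant-lead-g19/LEAD-NOTES-G19.md` N37 (4) and `prim-quant-lead-g19/FOR-PROVERS-F1.md`.
ONE `Prop` definition (the `@[conjecture]` `OneBigCert`, a closed-form real inequality), theorems otherwise; no sorries, standard axioms.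

THE CELL.  Floor `1/2 ≤ x < 1`; gates in `[x², 1]` (junk blobs removed, empty blobs sure); ONE blob `k` with `j < 2·a k ≤ 2j` (the 'big'), every
other blob of size `≤ j/2` (the 'cloud' `S`); discounted credit `> 2j`.  This is the worst cell of the residual class of T-DIB (README V227: true
margin 0.56, certificate margins 0.07–0.37).  Conditioning on the big (`RootDec.term_cond`; the B/S identity `term_eq_pairSet` with `T = {k}`):
`P(N ≥ j+1) = g k·TERM[a k, a|_{k↦0}] + (1 − g k)·TERM[0, a|_{k↦0}]`, and the two cloud terms are bounded below by KERNEL rules only — Markov on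
the closed mass (`term_ge_of_markov`), Cantelli (`term_ge_of_cantelli`), the disjunction of the smalls completing the big (`term_ge_disj_giants`,
each of closure `≤ 1 − x²`) — in terms of the cloud's AGGREGATES: total `A`, mean `m`, `S₂ = Σ a g(1−g)`, variance `V = Σ a² g(1−g)`, credit `c`, and
the number `n` of smalls completing the big.  The aggregates satisfy six one-line constraints (`phi_le_gate`, `gate_ge_floorSq_add`,
`gate_var_le`, sizes `≤ j/2` / `≤ ℓ`, `2A ≤ n·j` when `a k = j`).

* `Quant.IndepBlob.OneBigCert` (`@[conjecture]`) — THE REAL INEQUALITY: for all reals/naturals satisfying the constraints there are menu items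
  `z₁` (level `ℓ = j − a k`, menu {0, Markov, Cantelli, `1 − (1−x²)^n`}) and `z₀` (level `j`, menu {0, Markov, Cantelli}) with
  `x ≤ p·z₁ + (1 − p)·z₀`.  NUMERICALLY TRUE with minimum margin ≈ 0.067·(1−x) (lead g19 explore/f1red.py: after the monotonicity reductions a
  piecewise-rational inequality in four variables; worst near x ≈ 0.93, a k ≈ 0.99j, g k = x, A ≈ 1.16·c).  NOT PROVED here.
* **`Quant.IndepBlob.oneBig_row_of_cert : OneBigCert → (the DIB\* row for every F1 instance)`** — the kernel reduction.
* per-blob lemmas `phi_le_gate` (credit ≤ mean), `gate_ge_floorSq_add` (`x² + (1−x)φ(g) ≤ g`: the closed-mass constraint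
  `m ≥ x²A + (1−x)c`, ESSENTIAL — without it the aggregate relaxation is false), `gate_var_le` (`g(1−g) ≤ (1−x)(2g − φ(g))`, light case
  `= (g − x)²`; lead g18's granular lemma as a standalone statement).
[this work]; the gluing rows served [cite: KozmaNitzan2024, Conjecture 3 (p. 15)]; product weights [cite: Grimmett1999, §1.3 p. 10].
-/

namespace Summit.CriticalPhenomena.PercolationContinuityZ3.Theorems

namespace Quant

open Finset

namespace IndepBlob

/-! ### 1. Per-blob lemmas (gate `g ∈ [x², 1]`, rate `φ_x(g) = g` if `x ≤ g`, `(g − x²)/(1 − x)` otherwise) -/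

/-- Credit ≤ mean, per blob: `φ_x(g) ≤ g` (light case: `(g − x²)/(1−x) ≤ g ⟺ x·g ≤ x²`, i.e. `g ≤ x`, given `0 ≤ x`). [this work] -/
theorem phi_le_gate (x g : ℝ) (hx0 : 0 ≤ x) (hx1 : x < 1) :
    (if x ≤ g then g else (g - x ^ 2) / (1 - x)) ≤ g := by
  split_ifs with h
  · exact le_rfl
  · rw [div_le_iff₀ (by linarith)]
    nlinarith [mul_le_mul_of_nonneg_left (not_le.1 h).le hx0]

/-- The closed-mass constraint, per blob: `x² + (1 − x)·φ_x(g) ≤ g` (heavy: `x² ≤ x·g`; equality for light blobs), given `0 ≤ x`. [this work] -/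
theorem gate_ge_floorSq_add (x g : ℝ) (hx0 : 0 ≤ x) (hx1 : x < 1) :
    x ^ 2 + (1 - x) * (if x ≤ g then g else (g - x ^ 2) / (1 - x)) ≤ g := by
  split_ifs with h
  · nlinarith [mul_le_mul_of_nonneg_left h hx0]
  · rw [mul_div_cancel₀ _ (by linarith : (1 - x) ≠ 0)]
    linarith

/-- The variance constraint, per blob: `g(1 − g) ≤ (1 − x)(2g − φ_x(g))` for `0 ≤ x < 1` (heavy: `1 − g ≤ 1 − x`; light: the difference is
`(g − x)²` — lead g18's granular lemma as a standalone statement). [this work] -/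
theorem gate_var_le (x g : ℝ) (hx0 : 0 ≤ x) (hx1 : x < 1) :
    g * (1 - g) ≤ (1 - x) * (2 * g - (if x ≤ g then g else (g - x ^ 2) / (1 - x))) := by
  split_ifs with h
  · have hg0 : 0 ≤ g := hx0.trans h
    nlinarith [mul_le_mul_of_nonneg_left (by linarith : 1 - g ≤ 1 - x) hg0]
  · have h1x : (1 - x) ≠ 0 := by linarith
    have e : (1 - x) * (2 * g - (g - x ^ 2) / (1 - x)) = 2 * g * (1 - x) - (g - x ^ 2) := by
      rw [mul_sub, mul_div_cancel₀ _ h1x]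
      ring
    rw [e]
    nlinarith [sq_nonneg (g - x)]

/-! ### 2. The certificate -/

/-- **CONJECTURE — THE F1 CERTIFICATE (a closed-form real inequality; lead g19, N37 (4)).**  Data: floor `x`, the big blob (`p` = gate,
`b` = size, `ℓ = j − b`), the cloud aggregates `A` (total), `m` (mean), `s2 = Σ a g(1−g)`, `V = Σ a² g(1−g)`, `c` (discounted credit), `n` (number
of cloud blobs of size `≥ ℓ + 1`).  Hypotheses = the credit hypothesis split at the big + the six aggregate constraints.  Conclusion: menu items `z₁`
(level `ℓ`: 0 | Markov | Cantelli | disjunction of the `n` completing smalls) and `z₀` (level `j`: 0 | Markov | Cantelli) with `x ≤ p·z₁ + (1−p)·z₀`.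
Numerically true, minimum margin ≈ 0.067(1−x) (explore/f1red.py; FOR-PROVERS-F1.md).  `oneBig_row_of_cert` turns it into the DIB\* row for every
instance with exactly one blob of size `> j/2`.  builds on p205010 (kernel theorem, internal audit signed; external expert review pending).
[this work] [status: open] -/
@[conjecture] def OneBigCert : Prop :=
  ∀ (x p A m s2 V c : ℝ) (j b n : ℕ),
    1 / 2 ≤ x → x < 1 → x ^ 2 ≤ p → p ≤ 1 →
    j < 2 * b → b ≤ j →
    (2 * j : ℝ) < (b : ℝ) * (if x ≤ p then p else (p - x ^ 2) / (1 - x)) + c →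
    c ≤ m → x ^ 2 * A + (1 - x) * c ≤ m → m ≤ A →
    0 ≤ V → 0 ≤ s2 → s2 ≤ (1 - x) * (2 * m - c) → s2 ≤ m → s2 ≤ A - m →
    V ≤ ((j : ℝ) / 2) * s2 → (n = 0 → V ≤ ((j - b : ℕ) : ℝ) * s2) →
    (b = j → 2 * A ≤ (n : ℝ) * j) →
    ∃ z₁ z₀ : ℝ,
      (z₁ ≤ 0 ∨ (((j - b : ℕ) : ℝ) < A ∧ z₁ ≤ 1 - (A - m) / (A - ((j - b : ℕ) : ℝ)))
        ∨ (((j - b : ℕ) : ℝ) < m ∧ z₁ ≤ 1 - V / (V + (m - ((j - b : ℕ) : ℝ)) ^ 2))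
        ∨ z₁ ≤ 1 - (1 - x ^ 2) ^ n) ∧
      (z₀ ≤ 0 ∨ ((j : ℝ) < A ∧ z₀ ≤ 1 - (A - m) / (A - j)) ∨ ((j : ℝ) < m ∧ z₀ ≤ 1 - V / (V + (m - j) ^ 2))) ∧
      x ≤ p * z₁ + (1 - p) * z₀

end IndepBlob

namespace RootDec

variable {κ : Type} [Fintype κ] [DecidableEq κ]

/-- product-Bernoulli weight of the set `W` of open blobs (as in `…QuantRootReduction`) -/
local notation3 "wt[" g ", " W "]" => ∏ k, (if k ∈ (W : Finset κ) then (g : κ → ℝ) k else 1 - (g : κ → ℝ) k)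

/-- the TERM tail `P(s + Σ_{k open} a k ≥ j+1)` (as in `…QuantRootReduction`) -/
local notation3 "TERM[" s ", " a ", " g ", " j "]" =>
  ∑ W : Finset κ, wt[g, W] * (if (j : ℕ) + 1 ≤ (s : ℕ) + ∑ k ∈ W, (a : κ → ℕ) k then (1 : ℝ) else 0)

/-- The menu at one level, discharged: gates in `[0,1]`, sure part `s ≤ j`, `t = j − s` as a real, every blob of `G` a giant
(`j+1 ≤ s + a i`) with gate `≥ x²`; a real `z` certified by 0 | Markov | Cantelli | the disjunction of `G` is `≤ TERM[s, a, g, j]`. [this work] -/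
theorem term_ge_of_menu (s : ℕ) (a : κ → ℕ) (g : κ → ℝ) (j : ℕ) (hg : ∀ i, 0 ≤ g i ∧ g i ≤ 1) (hs : s ≤ j) (t : ℝ)
    (ht : ((j - s : ℕ) : ℝ) = t) (x z : ℝ)
    (G : Finset κ) (hG : ∀ i ∈ G, j + 1 ≤ s + a i) (hGx : ∀ i ∈ G, x ^ 2 ≤ g i)
    (hz : z ≤ 0 ∨ (t < ∑ i, (a i : ℝ) ∧ z ≤ 1 - ((∑ i, (a i : ℝ)) - ∑ i, (a i : ℝ) * g i) / ((∑ i, (a i : ℝ)) - t))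
        ∨ (t < ∑ i, (a i : ℝ) * g i ∧ z ≤ 1 - (∑ i, (a i : ℝ) ^ 2 * g i * (1 - g i)) /
            ((∑ i, (a i : ℝ) ^ 2 * g i * (1 - g i)) + ((∑ i, (a i : ℝ) * g i) - t) ^ 2))
        ∨ z ≤ 1 - (1 - x ^ 2) ^ G.card) :
    z ≤ TERM[s, a, g, j] := by
  subst ht
  rcases hz with h0 | ⟨hA, hM⟩ | ⟨hm, hC⟩ | hD
  · exact h0.trans (term_nonneg s a g j hg)
  · refine hM.trans (le_trans (le_of_eq ?_) (term_ge_of_markov s a g j hg hs hA))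
    have hne : (∑ i, (a i : ℝ)) - ((j - s : ℕ) : ℝ) ≠ 0 := by linarith
    field_simp
    ring
  · exact hC.trans (term_ge_of_cantelli s a g j hg hs hm)
  · refine hD.trans (le_trans ?_ (term_ge_disj_giants s a g j hg G hG))
    have hprod : ∏ i ∈ G, (1 - g i) ≤ (1 - x ^ 2) ^ G.card := by
      rw [← Finset.prod_const]
      exact Finset.prod_le_prod (fun i _ => by linarith [(hg i).2]) fun i hi => by linarith [hGx i hi]
    linarith

/-- **CELL F1 REDUCED: `OneBigCert` ⟹ the DIB\* row for every system with exactly one blob of size `> j/2`** (floor `1/2 ≤ x < 1`, gates in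
`[x², 1]`, the big `k` with `j < 2·a k ≤ 2j`, all other sizes `≤ j/2`, credit `> 2j`).  Proof: `term_cond` at `k`; the cloud's aggregates satisfy the
constraints of `OneBigCert` blob by blob; the menu items are discharged by `term_ge_of_menu`. [this work] -/
theorem oneBig_row_of_cert (hC : IndepBlob.OneBigCert) (a : κ → ℕ) (g : κ → ℝ) (j : ℕ) (x : ℝ) (hx : 1 / 2 ≤ x) (hx1 : x < 1)
    (hg : ∀ i, 0 ≤ g i ∧ g i ≤ 1) (hjunk : ∀ i, x ^ 2 ≤ g i) (k : κ) (hbig : j < 2 * a k) (hkj : a k ≤ j)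
    (hsmall : ∀ i, i ≠ k → 2 * a i ≤ j)
    (hcredit : (2 * j : ℝ) < ∑ i, (a i : ℝ) * (if x ≤ g i then g i else (g i - x ^ 2) / (1 - x))) :
    x ≤ ∑ W : Finset κ, wt[g, W] * (if j + 1 ≤ ∑ i ∈ W, a i then (1 : ℝ) else 0) := by
  have hx0 : 0 ≤ x := by linarith
  set φ : κ → ℝ := fun i => if x ≤ g i then g i else (g i - x ^ 2) / (1 - x) with hφ
  set b : ℕ := a k with hb
  set a' : κ → ℕ := Function.update a k 0 with ha'
  have ha'k : a' k = 0 := by simp [ha']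
  have ha'ne : ∀ i, i ≠ k → a' i = a i := fun i hi => by simp [ha', Function.update_of_ne hi]
  have ha'half : ∀ i, 2 * a' i ≤ j := by
    intro i; by_cases hi : i = k
    · rw [hi, ha'k]; exact Nat.zero_le _
    · rw [ha'ne i hi]; exact hsmall i hi
  -- split P(N ≥ j+1) at the big
  have e := term_cond 0 a g j k
  simp only [zero_add] at e
  rw [e, show a k = b from rfl, show Function.update a k 0 = a' from rfl]
  -- the credit of the cloud
  have hrest : ∑ i, (a' i : ℝ) * φ i = (∑ i, (a i : ℝ) * φ i) - b * φ k := by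
    have h1 : ∑ i, (a i : ℝ) * φ i = (a k : ℝ) * φ k + ∑ i ∈ Finset.univ.erase k, (a i : ℝ) * φ i :=
      (Finset.add_sum_erase _ _ (Finset.mem_univ k)).symm
    have h2 : ∑ i, (a' i : ℝ) * φ i = (a' k : ℝ) * φ k + ∑ i ∈ Finset.univ.erase k, (a' i : ℝ) * φ i :=
      (Finset.add_sum_erase _ _ (Finset.mem_univ k)).symm
    have h3 : ∑ i ∈ Finset.univ.erase k, (a' i : ℝ) * φ i = ∑ i ∈ Finset.univ.erase k, (a i : ℝ) * φ i :=
      Finset.sum_congr rfl fun i hi => by rw [ha'ne i (Finset.ne_of_mem_erase hi)]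
    rw [h2, h3, ha'k, Nat.cast_zero, zero_mul, zero_add, h1, hb]
    ring
  -- pointwise facts about the cloud
  have ha'0 : ∀ i, (0 : ℝ) ≤ a' i := fun i => Nat.cast_nonneg _
  have hgg : ∀ i, 0 ≤ g i * (1 - g i) := fun i => mul_nonneg (hg i).1 (sub_nonneg.2 (hg i).2)
  have hag : ∀ i, 0 ≤ (a' i : ℝ) * g i := fun i => mul_nonneg (ha'0 i) (hg i).1
  -- (c1) credit ≤ mean
  have hc1 : ∑ i, (a' i : ℝ) * φ i ≤ ∑ i, (a' i : ℝ) * g i := Finset.sum_le_sum fun i _ =>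
    mul_le_mul_of_nonneg_left (IndepBlob.phi_le_gate x (g i) hx0 hx1) (ha'0 i)
  -- (c2) the closed-mass constraint
  have hc2 : x ^ 2 * (∑ i, (a' i : ℝ)) + (1 - x) * (∑ i, (a' i : ℝ) * φ i) ≤ ∑ i, (a' i : ℝ) * g i := by
    rw [Finset.mul_sum, Finset.mul_sum, ← Finset.sum_add_distrib]
    refine Finset.sum_le_sum fun i _ => ?_
    have h := mul_le_mul_of_nonneg_left (IndepBlob.gate_ge_floorSq_add x (g i) hx0 hx1) (ha'0 i)
    have e : x ^ 2 * (a' i : ℝ) + (1 - x) * ((a' i : ℝ) * φ i) = (a' i : ℝ) * (x ^ 2 + (1 - x) * φ i) := by ring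
    rw [e]; exact h
  -- (c3) the variance constraint
  have hc3 : ∑ i, (a' i : ℝ) * g i * (1 - g i) ≤ (1 - x) * (2 * (∑ i, (a' i : ℝ) * g i) - ∑ i, (a' i : ℝ) * φ i) := by
    rw [Finset.mul_sum, ← Finset.sum_sub_distrib, Finset.mul_sum]
    refine Finset.sum_le_sum fun i _ => ?_
    have h := mul_le_mul_of_nonneg_left (IndepBlob.gate_var_le x (g i) hx0 hx1) (ha'0 i)
    have e1 : (a' i : ℝ) * g i * (1 - g i) = (a' i : ℝ) * (g i * (1 - g i)) := by ring
    have e2 : (1 - x) * (2 * ((a' i : ℝ) * g i) - (a' i : ℝ) * φ i) = (a' i : ℝ) * ((1 - x) * (2 * g i - φ i)) := by ring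
    rw [e1, e2]; exact h
  have hs2m : ∑ i, (a' i : ℝ) * g i * (1 - g i) ≤ ∑ i, (a' i : ℝ) * g i :=
    Finset.sum_le_sum fun i _ => by nlinarith [hag i, (hg i).1, (hg i).2]
  have hs2E : ∑ i, (a' i : ℝ) * g i * (1 - g i) ≤ (∑ i, (a' i : ℝ)) - ∑ i, (a' i : ℝ) * g i := by
    rw [← Finset.sum_sub_distrib]
    exact Finset.sum_le_sum fun i _ => by nlinarith [mul_nonneg (ha'0 i) (sq_nonneg (1 - g i))]
  have hs20 : 0 ≤ ∑ i, (a' i : ℝ) * g i * (1 - g i) :=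
    Finset.sum_nonneg fun i _ => by rw [mul_assoc]; exact mul_nonneg (ha'0 i) (hgg i)
  have hV0 : 0 ≤ ∑ i, (a' i : ℝ) ^ 2 * g i * (1 - g i) :=
    Finset.sum_nonneg fun i _ => by rw [mul_assoc]; exact mul_nonneg (sq_nonneg _) (hgg i)
  have hmA : ∑ i, (a' i : ℝ) * g i ≤ ∑ i, (a' i : ℝ) :=
    Finset.sum_le_sum fun i _ => by nlinarith [ha'0 i, (hg i).2]
  -- (c4) V ≤ (j/2)·s2, and V ≤ ℓ·s2 when no small completes the big
  have hc4 : ∑ i, (a' i : ℝ) ^ 2 * g i * (1 - g i) ≤ ((j : ℝ) / 2) * ∑ i, (a' i : ℝ) * g i * (1 - g i) := by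
    rw [Finset.mul_sum]
    refine Finset.sum_le_sum fun i _ => ?_
    have h : 2 * (a' i : ℝ) ≤ j := by exact_mod_cast ha'half i
    have h1 : (a' i : ℝ) ^ 2 ≤ ((j : ℝ) / 2) * (a' i : ℝ) := by nlinarith [ha'0 i]
    have e1 : (a' i : ℝ) ^ 2 * g i * (1 - g i) = (a' i : ℝ) ^ 2 * (g i * (1 - g i)) := by ring
    have e2 : ((j : ℝ) / 2) * ((a' i : ℝ) * g i * (1 - g i)) = (((j : ℝ) / 2) * (a' i : ℝ)) * (g i * (1 - g i)) := by ring
    rw [e1, e2]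
    exact mul_le_mul_of_nonneg_right h1 (hgg i)
  set G : Finset κ := Finset.univ.filter (fun i => j + 1 ≤ b + a' i) with hGdef
  have hG : ∀ i ∈ G, j + 1 ≤ b + a' i := fun i hi => (Finset.mem_filter.1 hi).2
  have hc4' : G.card = 0 → ∑ i, (a' i : ℝ) ^ 2 * g i * (1 - g i) ≤ ((j - b : ℕ) : ℝ) * ∑ i, (a' i : ℝ) * g i * (1 - g i) := by
    intro h0
    have hGe : G = ∅ := Finset.card_eq_zero.1 h0
    rw [Finset.mul_sum]
    refine Finset.sum_le_sum fun i _ => ?_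
    have hi : i ∉ G := by rw [hGe]; exact Finset.notMem_empty i
    rw [hGdef, Finset.mem_filter, not_and] at hi
    have hle : a' i ≤ j - b := by have := hi (Finset.mem_univ i); omega
    have h : (a' i : ℝ) ≤ ((j - b : ℕ) : ℝ) := by exact_mod_cast hle
    have h1 : (a' i : ℝ) ^ 2 ≤ ((j - b : ℕ) : ℝ) * (a' i : ℝ) := by nlinarith [ha'0 i]
    have e1 : (a' i : ℝ) ^ 2 * g i * (1 - g i) = (a' i : ℝ) ^ 2 * (g i * (1 - g i)) := by ring
    have e2 : ((j - b : ℕ) : ℝ) * ((a' i : ℝ) * g i * (1 - g i)) = (((j - b : ℕ) : ℝ) * (a' i : ℝ)) * (g i * (1 - g i)) := by ring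
    rw [e1, e2]
    exact mul_le_mul_of_nonneg_right h1 (hgg i)
  -- (c6) when the big has size j, every non-empty small completes it: 2A ≤ n·j
  have hc6 : b = j → 2 * (∑ i, (a' i : ℝ)) ≤ (G.card : ℝ) * j := by
    intro hbj
    have hGeq : ∀ i, i ∈ G ↔ 1 ≤ a' i := by
      intro i; rw [hGdef, Finset.mem_filter]; constructor
      · intro h; have := h.2; omega
      · intro h; exact ⟨Finset.mem_univ i, by omega⟩
    have hz : ∀ i, i ∉ G → (a' i : ℝ) = 0 := by
      intro i hi
      rw [hGeq] at hi
      have : a' i = 0 := by omega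
      rw [this, Nat.cast_zero]
    have hAG : ∑ i, (a' i : ℝ) = ∑ i ∈ G, (a' i : ℝ) := by
      rw [← Finset.sum_subset (Finset.subset_univ G) (fun i _ hi => hz i hi)]
    rw [hAG, Finset.mul_sum]
    have : ∑ i ∈ G, 2 * (a' i : ℝ) ≤ ∑ i ∈ G, (j : ℝ) :=
      Finset.sum_le_sum fun i _ => by exact_mod_cast ha'half i
    rw [Finset.sum_const, nsmul_eq_mul] at this
    exact this
  -- the certificate
  have hcred' : (2 * j : ℝ) < (b : ℝ) * φ k + ∑ i, (a' i : ℝ) * φ i := by rw [hrest]; linarith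
  have hφk : φ k = (if x ≤ g k then g k else (g k - x ^ 2) / (1 - x)) := rfl
  rw [hφk] at hcred'
  obtain ⟨z₁, z₀, hz₁, hz₀, hxz⟩ := hC x (g k) (∑ i, (a' i : ℝ)) (∑ i, (a' i : ℝ) * g i)
    (∑ i, (a' i : ℝ) * g i * (1 - g i)) (∑ i, (a' i : ℝ) ^ 2 * g i * (1 - g i)) (∑ i, (a' i : ℝ) * φ i) j b G.card
    hx hx1 (hjunk k) (hg k).2 hbig hkj hcred' hc1 hc2 hmA hV0 hs20 hc3 hs2m hs2E hc4 hc4' hc6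
  -- discharge the menu items
  have h1 : z₁ ≤ TERM[b, a', g, j] :=
    term_ge_of_menu b a' g j hg hkj ((j - b : ℕ) : ℝ) rfl x z₁ G hG (fun i _ => hjunk i) hz₁
  have h0 : z₀ ≤ ∑ W : Finset κ, wt[g, W] * (if j + 1 ≤ ∑ i ∈ W, a' i then (1 : ℝ) else 0) := by
    have h0' : z₀ ≤ TERM[0, a', g, j] := by
      refine term_ge_of_menu 0 a' g j hg (Nat.zero_le j) (j : ℝ) (by simp) x z₀ ∅ (fun i hi => absurd hi (Finset.notMem_empty i))
        (fun i hi => absurd hi (Finset.notMem_empty i)) ?_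
      rcases hz₀ with h | h | h
      · exact Or.inl h
      · exact Or.inr (Or.inl h)
      · exact Or.inr (Or.inr (Or.inl h))
    simpa only [zero_add] using h0'
  have e1 := mul_le_mul_of_nonneg_left h1 (hg k).1
  have e0 := mul_le_mul_of_nonneg_left h0 (sub_nonneg.2 (hg k).2)
  linarith

end RootDec

end Quant

end Summit.CriticalPhenomena.PercolationContinuityZ3.Theorems
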